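import Summits.CriticalPhenomena.SAWScalingLimit.Theorems.SAWDefectDecoherenceBoundaryClosureRZigzagDiscretisationConnected
import Literature.Probability.RandomPlanarGeometry.ExteriorULC
import HarnessLib

/-!
# Crux `BoundaryClosureR` (stmt-CriticalPhenomena-14004), line `polygon-parity-squeeze`,
# stub `stub_innerPolygonsOfZigzag` (7b): the trimmed discretisation is simply connected

Landing target:
`Summits/CriticalPhenomena/SAWScalingLimit/Theorems/SAWDefectDecoherenceBoundaryClosureRZigzagDiscretisationSimply.lean`
(`--supports stmt-CriticalPhenomena-14004`; building block of the registered stub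
`stub_innerPolygonsOfZigzag`, the lattice half of the inner-polygon construction (IP)).

* `eventually_simplyConnected` — **C2**: eventually `hexDomainSimplyConnected (Λ^P_δ)`, i.e. the
  complement of `Λ^P_δ` is preconnected in `ℍ`: every face of `Λ δ ∖ Λ^P_δ` walks outward through
  non-kept faces to the `r/16`-thick exterior of `P` (down-exits), where a uniform thick chain of the
  EXTERIOR of the Jordan domain `P` (open, connected: Jordan curve theorem, `ExteriorULC`) shadows a
  path of faces with centres off `closure P` (hence not kept) to a face far outside `Ω` (hence not in
  `Λ δ`); the complement of `Λ δ` is preconnected by `hexDomainSimplyConnected (Λ δ)`.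

Sources: folklore.  No proposition is defined and no named fact is introduced.
-/

noncomputable section

open scoped ComplexConjugate Topology
open Set Metric Filter
open Literature.Probability.LatticeModels Literature.Probability.RandomPlanarGeometry
  Literature.Probability.RandomPlanarGeometry.SAW

namespace Summit.CriticalPhenomena.SAWScalingLimit.Theorems.PolygonParitySqueeze.ZigzagDiscretisation

section C2

variable {D P : DobrushinDomain} {Cor : Finset ℂ} {κ : ℂ → Fin 6 × Fin 6 × Bool}
  {r ρ r₁ r₀ : ℝ} {Λ : ℝ → Finset HexVertex} {m m₀ : ℝ → ℤ} {a b : ℝ → Sym2 HexVertex}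

/-- Reachability in a larger induced subgraph. [folklore] -/
theorem reachable_induce_mono {T T' : Set HexVertex} (h : T ⊆ T') {u w : HexVertex} (hu : u ∈ T) (hw : w ∈ T)
    (hr : (hexGraph.induce T).Reachable ⟨u, hu⟩ ⟨w, hw⟩) :
    (hexGraph.induce T').Reachable ⟨u, h hu⟩ ⟨w, h hw⟩ :=
  hr.map (SimpleGraph.induceHomOfLE hexGraph h).toHom

/-- **C2: eventually the trimmed discretisation is simply connected.** [folklore] -/
theorem eventually_simplyConnected
    (hA : AdmissibleFamily D ρ Λ m b) (hP : PinnedFlatRoot D Λ b (D.pt 0) a r₀ m₀)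
    (hSD : P.carrier ⊆ D.carrier) (hr : 0 < r) (hrρ : r ≤ ρ / 16) (hrr₁ : r ≤ r₁ / 16) (hr₁r₀ : r₁ ≤ r₀)
    (hD0 : D.carrier ∩ ball (D.pt 0) r₁ = {z : ℂ | (D.pt 0).im < z.im} ∩ ball (D.pt 0) r₁)
    (hF : ∀ w ∈ frontier P.carrier, w ∉ ball (D.pt 1) (15 * ρ / 16) → w ∉ ball (D.pt 0) (15 * r₁ / 16) → w ∈ D.carrier)
    (hdist : ρ + r₁ ≤ dist (D.pt 0) (D.pt 1))
    (hCor : ∀ c ∈ Cor, c ∈ frontier P.carrier)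
    (hsep : ∀ c ∈ Cor, ∀ c' ∈ Cor, c ≠ c' → 4 * r ≤ dist c c')
    (hflat : ∀ z ∈ frontier P.carrier, (∀ c ∈ Cor, r ≤ dist z c) →
      ∃ k : Fin 6, P.carrier ∩ ball z (r / 2) = halfPlane k z ∩ ball z (r / 2))
    (Hκ : ∀ c ∈ Cor, ((κ c).2.2 = true ∧ P.carrier ∩ ball c (2 * r) = halfPlane (κ c).1 c ∩ halfPlane (κ c).2.1 c ∩ ball c (2 * r)) ∨
      ((κ c).2.2 = false ∧ P.carrier ∩ ball c (2 * r) = (halfPlane (κ c).1 c ∪ halfPlane (κ c).2.1 c) ∩ ball c (2 * r))) :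
    ∀ᶠ δ : ℝ in 𝓝[>] 0, hexDomainSimplyConnected (zdLam P.carrier Cor κ r (D.pt 1) (D.pt 0) ρ r₁ Λ m m₀ δ) := by
  set S := P.carrier with hS
  have hSne : S.Nonempty := P.nonempty
  -- the exterior and a far base point
  set E : Set ℂ := (closure S)ᶜ with hE
  have hEo : IsOpen E := P.toJordanDomain.isOpen_exterior
  have hEc : IsConnected E := P.toJordanDomain.isConnected_exterior
  have hEcompl : Eᶜ = closure S := compl_compl _
  have hEne : Eᶜ.Nonempty := by rw [hEcompl]; exact hSne.closure
  obtain ⟨R₀', hR₀'⟩ := (isBounded_iff_subset_closedBall 0).1 D.isBounded.closure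
  set R₀ : ℝ := max R₀' 0 with hR₀
  have hR₀0 : 0 ≤ R₀ := le_max_right _ _
  have hDR : closure D.carrier ⊆ closedBall 0 R₀ := hR₀'.trans (closedBall_subset_closedBall (le_max_left _ _))
  have hSR : closure S ⊆ closedBall 0 R₀ := (closure_mono hSD).trans hDR
  set y₀ : ℂ := ((R₀ + r + 10 : ℝ) : ℂ) with hy₀
  have hy₀n : ‖y₀‖ = R₀ + r + 10 := by rw [hy₀, Complex.norm_real, Real.norm_of_nonneg (by positivity)]
  have hfar₀ : ∀ y ∈ closedBall (0 : ℂ) R₀, r + 10 ≤ dist y₀ y := by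
    intro y hy
    rw [mem_closedBall, dist_zero_right] at hy
    have := norm_sub_norm_le y₀ y
    rw [← dist_eq_norm] at this
    linarith
  set K : Set ℂ := {y : ℂ | r / 16 ≤ infDist y (closure S)} ∩ closedBall 0 (R₀ + r + 10) with hK
  have hKc : IsCompact K := (isCompact_closedBall _ _).inter_left (isClosed_le continuous_const (continuous_infDist_pt _))
  have hKE : K ⊆ E := by
    rintro y ⟨hy, -⟩ hyc
    rw [mem_setOf_eq, infDist_zero_of_mem hyc] at hy
    linarith
  have hy₀K : y₀ ∈ K := by
    refine ⟨?_, mem_closedBall.2 (by rw [dist_zero_right, hy₀n])⟩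
    rw [mem_setOf_eq, le_infDist hSne.closure]
    intro y hy
    have := hfar₀ y (hSR hy)
    linarith
  obtain ⟨t, ht, hchain⟩ := thick_uniform hEo hEc hEne hKc hKE
  have hK2 := eventually_mem_zdLam_of_deep (r₁ := r₁) hA hP P.isOpen hSD hr hCor hsep hflat Hκ (show (0 : ℝ) < r / 16 by positivity)
  have hdnS := eventually_exit_down_side hA hP P.isOpen hSD hSne hr hrρ hrr₁ hr₁r₀ hD0 hF hdist hCor hsep hflat Hκ
  have hdnC := eventually_exit_down_corner hA hP P.isOpen hSD hSne hr hrρ hrr₁ hr₁r₀ hD0 hF hdist hCor hsep hflat Hκ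
  obtain ⟨hρ, -, hev, -, -⟩ := id hA
  have hδ1 : ∀ᶠ δ : ℝ in 𝓝[>] 0, δ ∈ Ioo (0 : ℝ) (min (t / 11) (min (r / 400) 1)) := Ioo_mem_nhdsGT (by positivity)
  filter_upwards [hK2, hdnS, hdnC, hev, hδ1] with δ hK2δ hdnSδ hdnCδ hevδ hδδ
  obtain ⟨hδ, hδm⟩ := hδδ
  have hδt : δ < t / 11 := hδm.trans_le (min_le_left _ _)
  have hδr : δ < r / 400 := hδm.trans_le ((min_le_right _ _).trans (min_le_left _ _))
  have hδ1' : δ < 1 := hδm.trans_le ((min_le_right _ _).trans (min_le_right _ _))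
  obtain ⟨hΛsc, -, -, hcar, -⟩ := hevδ
  set L := zdLam S Cor κ r (D.pt 1) (D.pt 0) ρ r₁ Λ m m₀ δ with hL
  set T : Set HexVertex := ((L : Finset HexVertex) : Set HexVertex)ᶜ with hT
  have hLΛ : ((Λ δ : Finset HexVertex) : Set HexVertex)ᶜ ⊆ T :=
    compl_subset_compl.2 (Finset.coe_subset.2 (zdLam_subset _ _ _ _ _ _ _ _ _ _ _ _))
  -- faces off `closure S` are not kept
  have offT : ∀ u : HexVertex, (δ : ℂ) * hexCenter u ∉ closure S → u ∈ T :=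
    fun u hu huL => hu (subset_closure (mem_carrier_of_mem_zdLam huL))
  -- Step 1: a non-kept face reaches (in `ℍ[T]`) a face of `K`
  have exit : ∀ u ∈ T, ∃ (u' : HexVertex) (hu : u ∈ T) (hu' : u' ∈ T), ((δ : ℂ) * hexCenter u' ∈ K ∨ u' ∉ Λ δ) ∧
      (hexGraph.induce T).Reachable ⟨u, hu⟩ ⟨u', hu'⟩ := by
    intro u hu
    by_cases huΛ : u ∈ Λ δ
    swap
    · exact ⟨u, hu, hu, Or.inr huΛ, SimpleGraph.Reachable.refl _⟩
    set p : ℂ := (δ : ℂ) * hexCenter u with hp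
    have hpD : p ∈ D.carrier := hcar u huΛ
    have hpR : p ∈ closedBall (0 : ℂ) R₀ := hDR (subset_closure hpD)
    -- the walk end is in `K` once it is `r/16` off `closure S` and within `r` of `p`
    have inK : ∀ q : ℂ, r / 16 ≤ infDist q (closure S) → dist q p ≤ r → q ∈ K := by
      intro q hq hqp
      refine ⟨hq, mem_closedBall.2 ?_⟩
      rw [mem_closedBall] at hpR
      calc dist q 0 ≤ dist q p + dist p 0 := dist_triangle _ _ _
        _ ≤ r + R₀ := by linarith
        _ ≤ R₀ + r + 10 := by linarith
    by_cases hdeep : r / 16 ≤ infDist p (closure S)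
    · exact ⟨u, hu, hu, Or.inl (inK p hdeep (by rw [dist_self]; exact hr.le)), SimpleGraph.Reachable.refl _⟩
    push Not at hdeep
    -- a frontier point within `r/16`
    obtain ⟨w, hwF, hwd⟩ : ∃ w ∈ frontier S, dist p w < r / 16 := by
      by_cases hpcl : p ∈ closure S
      · by_cases hpS : p ∈ S
        · have hSc : Sᶜ.Nonempty := ⟨y₀, fun h => hKE hy₀K (subset_closure h)⟩
          obtain ⟨w, hwF, hwd⟩ := exists_frontier_of_mem P.isOpen hSc hpS
          refine ⟨w, hwF, ?_⟩
          rw [hwd]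
          by_contra hcon
          push Not at hcon
          exact hu (hK2δ u hcon)
        · refine ⟨p, ?_, by rw [dist_self]; positivity⟩
          rw [P.isOpen.frontier_eq]; exact ⟨hpcl, hpS⟩
      · obtain ⟨w, hwF, hwd⟩ := exists_frontier_of_not_mem_closure hSne hpcl
        exact ⟨w, hwF, by rw [hwd]; exact hdeep⟩
    have hpw : p ∈ ball w (r / 8) := mem_ball.2 (by linarith)
    by_cases hfar : ∀ c ∈ Cor, r ≤ dist w c
    · obtain ⟨k, hk⟩ := hflat w hwF hfar
      obtain ⟨n, hwalk, hend, hnear⟩ := hdnSδ w hwF hfar k hk u hu hpw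
      obtain ⟨h0, hn, hreach⟩ := walk_reachable (T := T) (zdOpp k) u n fun i hi => hwalk i hi
      exact ⟨_, h0, hn, Or.inl (inK _ (by linarith [hend]) hnear), hreach⟩
    · push Not at hfar
      obtain ⟨c, hc, hwc⟩ := hfar
      have hpc : p ∈ ball c (9 * r / 8) := by
        rw [mem_ball]
        calc dist p c ≤ dist p w + dist w c := dist_triangle _ _ _
          _ < r / 16 + r := by gcongr
          _ ≤ 9 * r / 8 := by linarith
      obtain ⟨j, n, hwalk, hend, hnear⟩ := hdnCδ c hc u hu hpc
      obtain ⟨h0, hn, hreach⟩ := walk_reachable (T := T) j u n fun i hi => hwalk i hi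
      exact ⟨_, h0, hn, Or.inl (inK _ hend hnear), hreach⟩
  -- Step 2: a face of `K` reaches (in `ℍ[T]`) a face outside `Λ δ`
  have offT' : ∀ y : HexVertex, ∀ q : ℂ, 0 < infDist q (closure S) → dist ((δ : ℂ) * hexCenter y) q < infDist q (closure S) →
      y ∈ T := by
    intro y q hq hd
    apply offT
    intro hy
    have := infDist_le_dist_of_mem (x := q) hy
    rw [dist_comm] at hd
    linarith
  have escape : ∀ u : HexVertex, (δ : ℂ) * hexCenter u ∈ K → ∃ (u' : HexVertex) (hu : u ∈ T) (hu' : u' ∈ T),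
      u' ∉ Λ δ ∧ (hexGraph.induce T).Reachable ⟨u, hu⟩ ⟨u', hu'⟩ := by
    intro u huK
    obtain ⟨n, w, hw0, hwn, hstep, hdepth⟩ := hchain _ huK _ hy₀K
    simp only [hEcompl] at hdepth
    have hg : ∀ i : ℕ, ∃ x : Site 2, dist (hexCenter ((x, 0) : HexVertex)) ((δ : ℂ)⁻¹ * w i) ≤ 2 := fun i =>
      exists_face_near _
    choose gx hgx using hg
    set g : ℕ → HexVertex := fun i => ((gx i, 0) : HexVertex) with hgdef
    have hgd : ∀ i ≤ n, dist ((δ : ℂ) * hexCenter (g i)) (w i) ≤ 2 * δ := by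
      intro i _
      have := hgx i
      have e : w i = (δ : ℂ) * ((δ : ℂ)⁻¹ * w i) := by
        rw [← mul_assoc, mul_inv_cancel₀ (by exact_mod_cast hδ.ne'), one_mul]
      rw [e, dist_eq_norm, ← mul_sub, norm_mul, Complex.norm_real, Real.norm_of_nonneg hδ.le, ← dist_eq_norm]
      nlinarith
    have htube : ∀ i ≤ n, ∀ y : HexVertex, dist ((δ : ℂ) * hexCenter y) (w i) ≤ 4 * t + 22 * δ → y ∈ T := by
      intro i hi y hy
      have h1 := hdepth i hi
      exact offT' y (w i) (by linarith) (by linarith)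
    obtain ⟨hg0, hgn, hmid⟩ := chain_reachable hδ ht.le n w g hgd hstep htube
    -- the start: `u` to `g 0`
    have huT : u ∈ T := by
      refine offT u fun h => ?_
      have := huK.1
      rw [mem_setOf_eq, infDist_zero_of_mem h] at this
      linarith
    have hd0 : dist ((δ : ℂ) * hexCenter u) ((δ : ℂ) * hexCenter (g 0)) ≤ 2 * δ := by
      rw [dist_comm, ← hw0]; exact hgd 0 (Nat.zero_le _)
    obtain ⟨_, _, hstart⟩ := near_reachable (T := T) hδ (by positivity) u (g 0) hd0 fun y hy => by
      refine offT' y ((δ : ℂ) * hexCenter u) (by have := huK.1; rw [mem_setOf_eq] at this; linarith) ?_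
      have := huK.1
      rw [mem_setOf_eq] at this
      linarith
    -- the end: `g n` is off `Ω`
    have hgnΛ : g n ∉ Λ δ := by
      intro h
      have hD := subset_closure (hcar _ h)
      have h1 := hfar₀ _ (hDR hD)
      have h2 := hgd n le_rfl
      rw [hwn] at h2
      rw [dist_comm] at h1
      linarith
    exact ⟨g n, huT, hgn, hgnΛ, hstart.trans hmid⟩
  -- conclusion
  have out : ∀ v ∈ T, ∃ (v' : HexVertex) (hv : v ∈ T) (hv' : v' ∈ T), v' ∉ Λ δ ∧
      (hexGraph.induce T).Reachable ⟨v, hv⟩ ⟨v', hv'⟩ := by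
    intro v hv
    obtain ⟨u, hvT, huT, hu, hvu⟩ := exit v hv
    rcases hu with huK | huΛ
    · obtain ⟨u', _, hu'T, hu'Λ, huu'⟩ := escape u huK
      exact ⟨u', hvT, hu'T, hu'Λ, hvu.trans huu'⟩
    · exact ⟨u, hvT, huT, huΛ, hvu⟩
  rintro ⟨v, hv⟩ ⟨v', hv'⟩
  obtain ⟨u, hvT, huT, huΛ, hvu⟩ := out v hv
  obtain ⟨u', hv'T, hu'T, hu'Λ, hv'u'⟩ := out v' hv'
  have huc : u ∈ ((Λ δ : Finset HexVertex) : Set HexVertex)ᶜ := fun h => huΛ (Finset.mem_coe.1 h)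
  have hu'c : u' ∈ ((Λ δ : Finset HexVertex) : Set HexVertex)ᶜ := fun h => hu'Λ (Finset.mem_coe.1 h)
  have hmid : (hexGraph.induce T).Reachable ⟨u, huT⟩ ⟨u', hu'T⟩ :=
    reachable_induce_mono hLΛ huc hu'c (hΛsc ⟨u, huc⟩ ⟨u', hu'c⟩)
  exact (hvu.trans hmid).trans hv'u'.symm

end C2

/-- **Reachability in a larger induced subgraph** (registered form, sub-goal of `stub_innerPolygonsOfZigzag`). [folklore] -/
theorem zd_reachable_induce_mono : ∀ (T T' : Set HexVertex), T ⊆ T' → ∀ (u w : HexVertex) (hu : u ∈ T) (hw : w ∈ T), (hexGraph.induce T).Reachable ⟨u, hu⟩ ⟨w, hw⟩ → ∃ (hu' : u ∈ T') (hw' : w ∈ T'), (hexGraph.induce T').Reachable ⟨u, hu'⟩ ⟨w, hw'⟩ :=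
  fun _ _ h _ _ hu hw hr => ⟨h hu, h hw, reachable_induce_mono h hu hw hr⟩

end Summit.CriticalPhenomena.SAWScalingLimit.Theorems.PolygonParitySqueeze.ZigzagDiscretisation

end
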